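import Summits.QuantumFields.YangMills.Theorems.UnitScaleTiltHalvingP1FlatCoreSupplierDoor
import Summits.QuantumFields.YangMills.Theorems.UnitScaleTiltHalvingP1FlatCoreSupplierLandau
import Literature.MathematicalPhysics.QuantumFieldTheory.Balaban1983to89.B8Eq131CubesAdmissible
import HarnessLib

/-!
# `hP1room` PROGRAMME (LEAD-H «H = hSupU» BOARD v2 (S3)), (A-1) STAGE 3d FILE 1: ★★ FOUR OF THE DOOR's NINE ROWS FROM THE TOP-STEP CALL's OUTPUT — the knit of
# ✓`HalvingP1FlatCoreSupplierTopCall.topRows_of_datum`'s conclusion (at N05's cube member) into [R-b] `hnear`, [R-d] `hLanW`, [R-e] `htop`, [R-f]-sa of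
# ✓`HalvingP1FlatCoreSupplierDoor.hSup_of_contentRows`

Route `UnitScaleTilt`, crux K1 child «MinimiserStabilityRegPr» (stmt-QuantumFields-19200), registered stub `stub_halvingStep` (`BirthV10`), text `hP1room ⟸ hSupU`.
Cell `ym3-torus` (HUMAN RULING D-0037: YM₃ on T³ is ladder rung R3 — NOT d = 4, NOT a mass gap, NOT the Clay problem), width seat `ym-ust-20520-w3` gen 6.
`--supports stmt-QuantumFields-19200 --as helper`; THEOREMS ONLY (0 `def`, 0 `sorry`); count-neutral; nothing here claims `core′`, `hP1room`, `hSupU`, the stub, the crux or the gap.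

WHAT.  At one member∕site `(F, n < K, x₀)` with N05's window letters `(a, M′, ρ′)` and `k := K − n`: the top-step call is run at the cube member
`Ω j := cubeFam false L a M′ ρ′ k j` (= `cube L a M′ ρ′ k j`, ✓`cubeFam_false_of_le`) with the `k`-truncated structure `Λs k := cubeLamS L a M′ ρ′ k k`, the torus gauge `g`
(`W₁ := (U♯)^g`), F3's tower `κf`, the representative `rep s := lift x₀ + rel x₀ s` and `y₀ := Bᵏx₀`.  ★★ `doorRows_of_topRows`: from the call's output rows for ITS `λ`, `A`
— support off `Ω 0`, (1.108) on the sides touching `Ω 0`, the multiplier form on `Ω 0`, (top) on `Λs k k`, the level-`0` size of `A` on `Ω 0`, selfadjointness — and the windows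
`0 ≤ α₄ ≤ 1∕70`, `0 ≤ c_A ≤ 1∕12`: the door's rows [R-b] (`hnear`, its two `transl` premises unused), [R-d] (`hLanW`), [R-e] (`htop`, by `rfl` on the letters) and [R-f]-sa,
VERBATIM.  (The remaining rows: [R-a]∕[R-c] ✓∕⧗`…SupplierPreGauge`, [R-g] ✓`…SupplierFramesSU2`, [R-h] ✓`…TopSizesMember`, [R-f]-tr the τ-thread.)
HONEST SCOPE: letter plumbing (✓p643987 v1.1 `landau_and_near_of_topStepOutput` + one set identity); no analysis.

References: T. Bałaban, CMP **99** (1985) 75–102 [Balaban1985RegularSpaces] ((1.36)–(1.38) p.82, (1.107)–(1.109) p.94, (1.131) p.99).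
-/

set_option autoImplicit false

noncomputable section

open scoped BigOperators Matrix.Norms.L2Operator
open NormedSpace
open Complex (I)

namespace Summit.QuantumFields.YangMills.Theorems.HalvingP1FlatCoreSupplierTopKnit

open Literature.MathematicalPhysics.QuantumFieldTheory.Balaban1983to89
open Literature.MathematicalPhysics.QuantumFieldTheory.Balaban1983to89.T3ContinuumYM3Torus
open B5Eq118OneStroke (iterBlockOf)
open B7Prop1Explicit renaming Site → LSite
open B7Prop1Explicit (e expUnit)
open B7Eq78Linearization (conjR)
open B7Eq92Concrete (mgauge)
open B8Ineq132 (covDerivFwd)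
open B8Eq131Cubes (cube)
open B8Eq131CubesAdmissible (cubeFam cubeFam_false_of_le)
open B8Eq138LandauZd (covDivB covLap QT IsLandau138W)
open B8Eq140Level (SideTouches)
open B8Eq182Proof (gAd)
open B8Eq184Proof (gaugeExp cfgExp)
open B8Eq188Proof (frakF3)
open B8LambdaSpaceKLevel (wt)
open B8CubeMemberZd (cubeLamS)
open B10Eq27TorusAxialLog (transl rel unitsField toUField gaugeActT axialT)
open B15Eq112TorusCover (lift)
open Node00 (coverAt)
open FlatCubeSequenceAligned (cubeSetM)
open Summit.QuantumFields.YangMills.Theorems.Prop8ChartDoubleBar (dbarIterU)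
open HalvingP1FlatCoreSupplierLandau (landau_and_near_of_topStepOutput)

variable {F : T3Family} {n K : ℕ}

/-- ★★ **FOUR OF THE DOOR's NINE ROWS FROM THE TOP-STEP CALL's OUTPUT.**  See the module docstring.  Hypotheses: the window letters, `2 ≤ d`, the torus gauge `g`, the tower `κf`,
N05's output `(λ, A, μ)` at the cube member with its rows `hsa hsupp h108₀ hmult htopId hA0` (= conjuncts 1, 2, 3 at `j = 0`, 4, 6, 7 of
✓`HalvingP1FlatCoreSupplierTopCall.topRows_of_datum` at `Ω := cubeFam false L a M′ ρ′ k`, `Λs (m+1) := cubeLamS L a M′ ρ′ k`, `m + 1 := k`, `rep`, `y₀`, `W₁ := (U♯)^g`), the windows.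
Conclusion: [R-b] ∧ [R-d] ∧ [R-e] ∧ [R-f]-sa of ✓`hSup_of_contentRows`, VERBATIM. [cite: Balaban1985RegularSpaces, (1.36)-(1.38) p.82, (1.107)-(1.109) p.94, (1.131) p.99] -/
theorem doorRows_of_topRows (hd2 : 2 ≤ (F.P K).d) (x₀ : Site (F.P K) 0) (ρ S M : ℕ) {a : LSite (F.P K).d} {M' ρ' : ℕ}
    (U : GaugeField (F.P K) 0 (Matrix.specialUnitaryGroup (Fin 2) ℂ))
    (g : GaugeTransf (F.P K) 0 (Matrix (Fin 2) (Fin 2) ℂ)ˣ)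
    (κf : (Site (F.P K) 0 → Matrix (Fin 2) (Fin 2) ℂ) → (i : ℕ) → GaugeTransf (F.P K) i (Matrix (Fin 2) (Fin 2) ℂ)ˣ)
    {A : LSite (F.P K).d → Fin (F.P K).d → Matrix (Fin 2) (Fin 2) ℂ} {lam : LSite (F.P K).d → Matrix (Fin 2) (Fin 2) ℂ} {α₄ cA : ℝ}
    (hα0 : 0 ≤ α₄) (hα : α₄ ≤ 1 / 70) (hcA0 : 0 ≤ cA) (hcA : cA ≤ 1 / 12)
    -- the top-step call's output rows at the cube member
    (hsa : ∀ x, IsSelfAdjoint (lam x))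
    (hsupp : ∀ x, x ∉ cubeFam false (F.P K).L a M' ρ' (K - n) 0 → lam x = 0)
    (h108₀ : ∀ b ∈ {b : LSite (F.P K).d × Fin (F.P K).d | SideTouches (cubeFam false (F.P K).L a M' ρ' (K - n) 0) b.1 b.2},
      ‖lam b.1‖ ≤ α₄ ∧ wt (F.P K).L (((F.L : ℝ)⁻¹) ^ (K - n)) 0 *
        ‖covDerivFwd (((F.L : ℝ)⁻¹) ^ (K - n)) (1 : LSite (F.P K).d → Fin (F.P K).d → (Matrix (Fin 2) (Fin 2) ℂ)ˣ) b.2 lam b.1‖ ≤ α₄)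
    (hmult : ∃ μ : ℕ → LSite (F.P K).d → Matrix (Fin 2) (Fin 2) ℂ, ∀ x ∈ cubeFam false (F.P K).L a M' ρ' (K - n) 0,
      covLap (((F.L : ℝ)⁻¹) ^ (K - n)) (1 : LSite (F.P K).d → Fin (F.P K).d → (Matrix (Fin 2) (Fin 2) ℂ)ˣ)
        ((cubeFam false (F.P K).L a M' ρ' (K - n) 0).indicator fun y =>
          covDivB (((F.L : ℝ)⁻¹) ^ (K - n)) (1 : LSite (F.P K).d → Fin (F.P K).d → (Matrix (Fin 2) (Fin 2) ℂ)ˣ) A y +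
          covLap (((F.L : ℝ)⁻¹) ^ (K - n)) (1 : LSite (F.P K).d → Fin (F.P K).d → (Matrix (Fin 2) (Fin 2) ℂ)ˣ) lam y +
          ((conjR (gaugeExp lam y)⁻¹ (covDivB (((F.L : ℝ)⁻¹) ^ (K - n)) (1 : LSite (F.P K).d → Fin (F.P K).d → (Matrix (Fin 2) (Fin 2) ℂ)ˣ) A y) -
              covDivB (((F.L : ℝ)⁻¹) ^ (K - n)) (1 : LSite (F.P K).d → Fin (F.P K).d → (Matrix (Fin 2) (Fin 2) ℂ)ˣ) A y) +
            (gAd (covLap (((F.L : ℝ)⁻¹) ^ (K - n)) (1 : LSite (F.P K).d → Fin (F.P K).d → (Matrix (Fin 2) (Fin 2) ℂ)ˣ) lam y) (lam y) -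
              covLap (((F.L : ℝ)⁻¹) ^ (K - n)) (1 : LSite (F.P K).d → Fin (F.P K).d → (Matrix (Fin 2) (Fin 2) ℂ)ˣ) lam y) +
            ∑ μ, frakF3 (((F.L : ℝ)⁻¹) ^ (K - n)) (1 : LSite (F.P K).d → Fin (F.P K).d → (Matrix (Fin 2) (Fin 2) ℂ)ˣ) lam A y μ)) x =
        QT (F.P K).L (K - n) (cubeLamS (F.P K).L a M' ρ' (K - n) (K - n)) (1 : LSite (F.P K).d → Fin (F.P K).d → (Matrix (Fin 2) (Fin 2) ℂ)ˣ) μ x)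
    (htopId : ∀ yc ∈ cubeLamS (F.P K).L a M' ρ' (K - n) (K - n) (K - n),
      κf (((-I) • lam) ∘ fun s : Site (F.P K) 0 => lift (F.P K) x₀ + rel x₀ s) (K - n) (coverAt (F.P K) (K - n) yc) =
        axialT (dbarIterU (K - n) (gaugeActT g (unitsField (toUField U)))) (iterBlockOf (K - n) x₀) (coverAt (F.P K) (K - n) yc))
    (hA0 : ∀ x ∈ cubeFam false (F.P K).L a M' ρ' (K - n) 0, ∀ μ : Fin (F.P K).d,
      wt (F.P K).L (((F.L : ℝ)⁻¹) ^ (K - n)) 0 * ‖A x μ‖ ≤ cA ∧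
        wt (F.P K).L (((F.L : ℝ)⁻¹) ^ (K - n)) 0 *
          ‖conjR ((1 : LSite (F.P K).d → Fin (F.P K).d → (Matrix (Fin 2) (Fin 2) ℂ)ˣ) (x - e μ) μ)⁻¹ (A (x - e μ) μ)‖ ≤ cA) :
    -- [R-b] hnear
    (∀ z ∈ cube (F.P K).L a M' ρ' (K - n) 0, ∀ ν' : Fin (F.P K).d,
      transl (0 : Site (F.P K) 0) z ∈ cubeSetM x₀ (K - n) ρ S M 0 → (transl (0 : Site (F.P K) 0) z).shift ν' ∈ cubeSetM x₀ (K - n) ρ S M 0 →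
      ‖((mgauge (1 : LSite (F.P K).d → Fin (F.P K).d → (Matrix (Fin 2) (Fin 2) ℂ)ˣ) (gaugeExp lam)⁻¹ (cfgExp (((F.L : ℝ)⁻¹) ^ (K - n)) A) z ν' :
        (Matrix (Fin 2) (Fin 2) ℂ)ˣ) : Matrix (Fin 2) (Fin 2) ℂ) - 1‖ ≤ 1 / 4) ∧
    -- [R-d] hLanW
    IsLandau138W (F.P K).L (K - n) (((F.L : ℝ)⁻¹) ^ (K - n)) (cube (F.P K).L a M' ρ' (K - n) 0) (cubeLamS (F.P K).L a M' ρ' (K - n) (K - n))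
      (1 : LSite (F.P K).d → Fin (F.P K).d → (Matrix (Fin 2) (Fin 2) ℂ)ˣ)
      (mgauge (1 : LSite (F.P K).d → Fin (F.P K).d → (Matrix (Fin 2) (Fin 2) ℂ)ˣ) (gaugeExp lam)⁻¹ (cfgExp (((F.L : ℝ)⁻¹) ^ (K - n)) A)) ∧
    -- [R-e] htop
    (∀ yc ∈ cubeLamS (F.P K).L a M' ρ' (K - n) (K - n) (K - n),
      κf (((-I) • lam) ∘ fun s : Site (F.P K) 0 => lift (F.P K) x₀ + rel x₀ s) (K - n) (coverAt (F.P K) (K - n) yc) =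
        axialT (dbarIterU (K - n) (gaugeActT g (unitsField (toUField U)))) (iterBlockOf (K - n) x₀) (coverAt (F.P K) (K - n) yc)) ∧
    -- [R-f]-sa
    (∀ z : LSite (F.P K).d, IsSelfAdjoint (lam z)) := by
  have hL0 : (0 : ℝ) < F.L := by exact_mod_cast (F.P K).L_pos
  have hη : 0 < ((F.L : ℝ)⁻¹) ^ (K - n) := by positivity
  -- the window in N05's two spellings
  have hΩ : cubeFam false (F.P K).L a M' ρ' (K - n) 0 = cube (F.P K).L a M' ρ' (K - n) 0 := cubeFam_false_of_le _ _ _ _ (Nat.zero_le _)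
  rw [hΩ] at hsupp h108₀ hmult hA0
  obtain ⟨hLan, hnear⟩ := landau_and_near_of_topStepOutput hd2 hη (F.P K).L (K - n) (cube (F.P K).L a M' ρ' (K - n) 0)
    (cubeLamS (F.P K).L a M' ρ' (K - n) (K - n)) hα0 hα hcA0 hcA hsupp h108₀ hA0 hmult
  exact ⟨fun z hz ν' _ _ => hnear z hz ν', hLan, htopId, hsa⟩

end Summit.QuantumFields.YangMills.Theorems.HalvingP1FlatCoreSupplierTopKnit

end
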